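import Mathlib
import Summits.ValiantsHypothesis.ValiantsHypothesis.Theorems.NewtonUnitEquationsNewtonTauWeakCornerFibre

/-!
# `NewtonTauWeak` (stmt-ValiantsHypothesis-5904), stub `fixedKCoincidence_t2_K3` (siege k8, polynomial-identity
# route): the TWO-FOLD corner model — words, single-product fibre sums, and the normalisation step

Support file for the registered sub-stub `fixedKCoincidence_t2_K3` (FixedKCoincidence at `t = 2`, `K = 3`, no
short 2-vs-1 relations) of the open stub `stub_binomialNewtonTauCommon` of the crux
`Summit.ValiantsHypothesis.ValiantsHypothesis.Theses.NewtonUnitEquations.NewtonTauWeak`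
(KPTT arXiv:1308.2286 Conj. 1 at sparsity `2`).

Lead c2's `K = 3` corner rigidity lemma (`…CornerRigidity.lean`) treats a common corner of all THREE products.
After the flip identity the second configuration that produces cancellation is a corner shared by exactly TWO
products whose scalars cancel, the third product sitting at a lattice vector `u` of positive weight above it
(this happens as soon as some coefficients `ρ_{lj}` vanish).  Dividing by the first product gives the TWO-FOLD
corner model
`H = κ X^u Π_e V_e(X^{E_e}) - (Π_e U_e(X^{E_e}) - 1)`, `U_e(0) = V_e(0) = 1`,
whose coefficient at `z ≠ 0` is `κ · fib_V(z - u) - fib_U(z)` with the single-product fibre sums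
`fib_P = fibreSum E D 1 0 P P` of the corner model (`…CornerDefs.lean`; coinciding subset sums allowed).

This file (first of two): routine facts on words and single-product fibre sums (`k8_fib_zero`,
`k8_exists_active_letter`, `k8_mixed_gt`, …), the degenerate `K = 2` statement `k8_pure_offRay_false` (the
`w`-initial exponent of `Π_e U_e(X^{E_e}) - 1` is never off-ray), and the NORMALISATION step `k8_two_norm`: if the
`w`-initial exponent `v` of the two-fold model is off-ray then either `v = u` (the upper corner survives) or `u` is
the lightest order point `o_a E_a` of `U` and `κ = [s^{o_a}] U_a` (the two lightest terms cancel).  The rigidity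
statement proper is `k8_corner_two_rigidity` in `…K8TwoFold.lean`.  No definitions. [this line; new, elementary]
-/

-- the namespace mandated for this Theorems file repeats the component `ValiantsHypothesis`
set_option linter.dupNamespace false

noncomputable section

open scoped BigOperators Polynomial

namespace Summit.ValiantsHypothesis.ValiantsHypothesis.Theorems.NewtonTauWeakCorner

/-! ## Words: two letters, sub-sums of the weight -/

/-- A word with at least two nonzero letters has two distinct nonzero letters. [folklore] -/
theorem k8_two_letters {s : ℕ} {n : Fin s → ℕ} (h2 : 2 ≤ (Finset.univ.filter fun x => n x ≠ 0).card) :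
    ∃ e₁ e₂ : Fin s, e₁ ≠ e₂ ∧ n e₁ ≠ 0 ∧ n e₂ ≠ 0 := by
  obtain ⟨a, ha, b, hb, hab⟩ := Finset.one_lt_card.mp (by omega :
    1 < (Finset.univ.filter fun x => n x ≠ 0).card)
  exact ⟨a, b, hab, (Finset.mem_filter.mp ha).2, (Finset.mem_filter.mp hb).2⟩

/-- One letter's contribution is at most the weight of the word (positive weights). [folklore] -/
theorem k8_letter_le_wt_push {s : ℕ} (E : Fin s → Fin 2 → ℤ) (w : Fin 2 → ℝ) (hw : ∀ e, 0 < wt w (E e))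
    (n : Fin s → ℕ) (e : Fin s) : (n e : ℝ) * wt w (E e) ≤ wt w (push E n) := by
  rw [wt_push]
  exact Finset.single_le_sum (f := fun x => (n x : ℝ) * wt w (E x))
    (fun x _ => mul_nonneg (Nat.cast_nonneg _) (hw x).le) (Finset.mem_univ e)

/-- A nonzero letter of a word with nonzero separated coefficient is an active direction, of order at most the
letter. [folklore] -/
theorem k8_active_order_le {s : ℕ} {P : Fin s → ℂ[X]} {o : Fin s → ℕ}
    (ho : ∀ e, Active (P e) → IsOrder (P e) (o e)) {n : Fin s → ℕ} (hP : sepCoeff P n ≠ 0) {e : Fin s}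
    (he : n e ≠ 0) : Active (P e) ∧ o e ≤ n e := by
  have h1 : 1 ≤ n e := Nat.one_le_iff_ne_zero.mpr he
  have hc : (P e).coeff (n e) ≠ 0 := sepCoeff_ne_zero_apply hP e
  have hA : Active (P e) := active_of_coeff_ne_zero h1 hc
  exact ⟨hA, (ho e hA).le_of_coeff_ne_zero h1 hc⟩

/-- **Mixed words are strictly heavier than the lightest order.**  If `o_a⟨w,E_a⟩ ≤ o_e⟨w,E_e⟩` for every
active direction `e` of `P`, then every word with two nonzero letters and nonzero separated coefficient weighs
strictly more than `o_a⟨w,E_a⟩`. [folklore] -/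
theorem k8_mixed_gt {s : ℕ} (E : Fin s → Fin 2 → ℤ) (w : Fin 2 → ℝ) (hw : ∀ e, 0 < wt w (E e))
    (P : Fin s → ℂ[X]) (o : Fin s → ℕ) (ho : ∀ e, Active (P e) → IsOrder (P e) (o e)) (a : Fin s)
    (hamin : ∀ e, Active (P e) → (o a : ℝ) * wt w (E a) ≤ (o e : ℝ) * wt w (E e))
    (n : Fin s → ℕ) (hn2 : 2 ≤ (Finset.univ.filter fun x => n x ≠ 0).card) (hP : sepCoeff P n ≠ 0) :
    (o a : ℝ) * wt w (E a) < wt w (push E n) := by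
  obtain ⟨e₁, e₂, hne, h1, h2⟩ := k8_two_letters hn2
  obtain ⟨hA1, ho1⟩ := k8_active_order_le ho hP h1
  have i1 : (o a : ℝ) * wt w (E a) ≤ (n e₁ : ℝ) * wt w (E e₁) :=
    (hamin e₁ hA1).trans (mul_le_mul_of_nonneg_right (by exact_mod_cast ho1) (hw e₁).le)
  have i2 : 0 < (n e₂ : ℝ) * wt w (E e₂) :=
    mul_pos (by exact_mod_cast Nat.pos_of_ne_zero h2) (hw e₂)
  have i3 : (n e₁ : ℝ) * wt w (E e₁) + (n e₂ : ℝ) * wt w (E e₂) ≤ wt w (push E n) := by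
    classical
    rw [wt_push, ← Finset.sum_pair (f := fun x => (n x : ℝ) * wt w (E x)) hne]
    exact Finset.sum_le_sum_of_subset_of_nonneg (Finset.subset_univ _)
      fun x _ _ => mul_nonneg (Nat.cast_nonneg _) (hw x).le
  linarith

/-! ## Single-product fibre sums `fibreSum E D 1 0 P P` -/

/-- A nonzero single-product fibre sum is witnessed by a word of the box with nonzero separated coefficient.
[folklore] -/
theorem k8_exists_word {s D : ℕ} {E : Fin s → Fin 2 → ℤ} {P : Fin s → ℂ[X]} {z : Fin 2 → ℤ}
    (h : fibreSum E D 1 0 P P z ≠ 0) : ∃ n ∈ box s D, push E n = z ∧ sepCoeff P n ≠ 0 := by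
  unfold fibreSum at h
  obtain ⟨n, hn, hne⟩ := Finset.exists_ne_zero_of_sum_ne_zero h
  obtain ⟨hbox, hpush⟩ := Finset.mem_filter.mp hn
  exact ⟨n, hbox, hpush, fun h0 => hne (by rw [h0]; ring)⟩

/-- The empty word lies in the box. [folklore] -/
theorem k8_zero_mem_box (s D : ℕ) : (0 : Fin s → ℕ) ∈ box s D := by
  simp [box, Fintype.mem_piFinset]

/-- The separated coefficient of the empty word is `1` when all constant terms are `1`. [folklore] -/
theorem k8_sepCoeff_zero {s : ℕ} (P : Fin s → ℂ[X]) (hP0 : ∀ e, (P e).coeff 0 = 1) :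
    sepCoeff P 0 = 1 := by
  unfold sepCoeff
  exact Finset.prod_eq_one fun e _ => by simp [hP0]

/-- The fibre sum at the origin is `1` (only the empty word pushes to the origin). [folklore] -/
theorem k8_fib_zero {s D : ℕ} (E : Fin s → Fin 2 → ℤ) (w : Fin 2 → ℝ) (hw : ∀ e, 0 < wt w (E e))
    (P : Fin s → ℂ[X]) (hP0 : ∀ e, (P e).coeff 0 = 1) : fibreSum E D 1 0 P P 0 = 1 := by
  classical
  unfold fibreSum
  rw [Finset.sum_eq_single_of_mem (0 : Fin s → ℕ)]
  · rw [k8_sepCoeff_zero P hP0]; ring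
  · exact Finset.mem_filter.mpr ⟨k8_zero_mem_box s D, push_zero E⟩
  · intro n hn hne
    exfalso
    obtain ⟨-, hpush⟩ := Finset.mem_filter.mp hn
    apply hne
    funext e
    by_contra hne'
    have hpos : 0 < (n e : ℝ) * wt w (E e) := mul_pos (by exact_mod_cast Nat.pos_of_ne_zero hne') (hw e)
    have h1 := k8_letter_le_wt_push E w hw n e
    rw [hpush, wt_zero] at h1
    linarith

/-- A nonzero fibre sum sits at a point of nonnegative weight. [folklore] -/
theorem k8_wt_nonneg_of_fib_ne_zero {s D : ℕ} (E : Fin s → Fin 2 → ℤ) (w : Fin 2 → ℝ)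
    (hw : ∀ e, 0 < wt w (E e)) (P : Fin s → ℂ[X]) {z : Fin 2 → ℤ} (h : fibreSum E D 1 0 P P z ≠ 0) :
    0 ≤ wt w z := by
  obtain ⟨n, -, hpush, -⟩ := k8_exists_word h
  rw [← hpush, wt_push]
  exact Finset.sum_nonneg fun x _ => mul_nonneg (Nat.cast_nonneg _) (hw x).le

/-- A nonzero fibre sum at a nonzero point is reached by a word with an active letter, whose order weight is at
most the weight of the point. [folklore] -/
theorem k8_exists_active_letter {s D : ℕ} (E : Fin s → Fin 2 → ℤ) (w : Fin 2 → ℝ)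
    (hw : ∀ e, 0 < wt w (E e)) (P : Fin s → ℂ[X]) (o : Fin s → ℕ)
    (ho : ∀ e, Active (P e) → IsOrder (P e) (o e)) {z : Fin 2 → ℤ} (hz : z ≠ 0)
    (h : fibreSum E D 1 0 P P z ≠ 0) :
    ∃ e, Active (P e) ∧ (o e : ℝ) * wt w (E e) ≤ wt w z := by
  obtain ⟨n, -, hpush, hP⟩ := k8_exists_word h
  have hn : n ≠ 0 := by
    rintro rfl
    rw [push_zero] at hpush
    exact hz hpush.symm
  obtain ⟨e, he⟩ : ∃ e, n e ≠ 0 := by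
    by_contra hall
    push Not at hall
    exact hn (funext hall)
  obtain ⟨hA, hoe⟩ := k8_active_order_le ho hP he
  refine ⟨e, hA, ?_⟩
  rw [← hpush]
  exact (mul_le_mul_of_nonneg_right (by exact_mod_cast hoe) (hw e).le).trans (k8_letter_le_wt_push E w hw n e)

/-- The fibre sum at an order point below every mixed word is the pure coefficient (single-product form of
`fibreSum_pure`). [folklore] -/
theorem k8_fib_orderPoint {s D : ℕ} (E : Fin s → Fin 2 → ℤ) (w : Fin 2 → ℝ) (hw : ∀ e, 0 < wt w (E e))
    (hE : ∀ e e' : Fin s, ∀ k k' : ℕ, 1 ≤ k → (k : ℤ) • E e = (k' : ℤ) • E e' → e = e')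
    (P : Fin s → ℂ[X]) (hP0 : ∀ e, (P e).coeff 0 = 1) (hPD : ∀ e, (P e).natDegree ≤ D)
    (o : Fin s → ℕ) (ho : ∀ e, Active (P e) → IsOrder (P e) (o e)) (a : Fin s) (haA : Active (P a))
    (hamin : ∀ e, Active (P e) → (o a : ℝ) * wt w (E a) ≤ (o e : ℝ) * wt w (E e)) :
    fibreSum E D 1 0 P P ((o a : ℤ) • E a) = (P a).coeff (o a) := by
  have hoa := ho a haA
  rw [fibreSum_pure E w hw hE 1 0 P P hP0 hP0 a (o a) hoa.1 (hoa.le_natDegree.trans (hPD a))]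
  · ring
  · intro n _ h2 hPn
    have hPn' : sepCoeff P n ≠ 0 := by rcases hPn with h | h <;> exact h
    have := k8_mixed_gt E w hw P o ho a hamin n h2 hPn'
    rw [wt_zsmul]; push_cast; linarith

/-! ## The degenerate case: one separated product minus one has no off-ray initial exponent -/

/-- **`K = 2` at the corner.** For a single separated product `Π_e U_e(X^{E_e})` with `U_e(0) = 1`, no OFF-RAY
nonzero lattice point can be the `w`-initial exponent of `Π_e U_e(X^{E_e}) - 1`: a contributing word is mixed,
so the lightest order point of `U` is lighter and uncancelled (lead c1's ray lemma, in fibre-sum form).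
[folklore; KPTT arXiv:1308.2286 context] -/
theorem k8_pure_offRay_false {s D : ℕ} (E : Fin s → Fin 2 → ℤ) (w : Fin 2 → ℝ)
    (hw : ∀ e, 0 < wt w (E e))
    (hE : ∀ e e' : Fin s, ∀ k k' : ℕ, 1 ≤ k → (k : ℤ) • E e = (k' : ℤ) • E e' → e = e')
    (U : Fin s → ℂ[X]) (hU0 : ∀ e, (U e).coeff 0 = 1) (hUD : ∀ e, (U e).natDegree ≤ D)
    (v : Fin 2 → ℤ) (hv0 : v ≠ 0) (hoff : ¬ OnRay E v) (hv : fibreSum E D 1 0 U U v ≠ 0)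
    (hcanc : ∀ z, z ≠ 0 → wt w z < wt w v → fibreSum E D 1 0 U U z = 0) : False := by
  classical
  -- an order function
  let o : Fin s → ℕ := fun e => if h : Active (U e) then Classical.choose (exists_isOrder h) else 0
  have ho : ∀ e, Active (U e) → IsOrder (U e) (o e) := by
    intro e h; simp only [o, dif_pos h]; exact Classical.choose_spec (exists_isOrder h)
  -- a contributing word is mixed, so some direction is active
  obtain ⟨n, -, hpush, hUn⟩ := k8_exists_word hv
  have h2 := two_le_card_of_offRay E hpush hv0 hoff
  obtain ⟨e₁, -, -, h1, -⟩ := k8_two_letters h2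
  have hA1 : Active (U e₁) := (k8_active_order_le ho hUn h1).1
  -- the lightest active order
  set AU := Finset.univ.filter fun e => Active (U e) with hAU
  have hAUne : AU.Nonempty := ⟨e₁, Finset.mem_filter.mpr ⟨Finset.mem_univ _, hA1⟩⟩
  obtain ⟨a, ha, hamin⟩ := AU.exists_min_image (fun e => (o e : ℝ) * wt w (E e)) hAUne
  have haA : Active (U a) := (Finset.mem_filter.mp ha).2
  have hamin' : ∀ e, Active (U e) → (o a : ℝ) * wt w (E a) ≤ (o e : ℝ) * wt w (E e) :=
    fun e he => hamin e (Finset.mem_filter.mpr ⟨Finset.mem_univ _, he⟩)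
  have hoa := ho a haA
  -- the order point `r = o_a E_a` is lighter than `v` and uncancelled
  have hwr : wt w ((o a : ℤ) • E a) = (o a : ℝ) * wt w (E a) := by rw [wt_zsmul]; push_cast; ring
  have hrpos : 0 < wt w ((o a : ℤ) • E a) := by
    rw [hwr]; exact mul_pos (by exact_mod_cast hoa.1) (hw a)
  have hr0 : ((o a : ℤ) • E a) ≠ 0 := by
    intro h; rw [h, wt_zero] at hrpos; exact lt_irrefl _ hrpos
  have hlt : wt w ((o a : ℤ) • E a) < wt w v := by
    rw [hwr, ← hpush]; exact k8_mixed_gt E w hw U o ho a hamin' n h2 hUn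
  have h0 := hcanc _ hr0 hlt
  rw [k8_fib_orderPoint E w hw hE U hU0 hUD o ho a haA hamin'] at h0
  exact hoa.2.1 h0

/-! ## The two-fold model: normalisation -/

/-- **Normalisation of the two-fold corner model.**  Two-fold model `κ X^u Π V_e(X^{E_e}) - (Π U_e(X^{E_e}) - 1)`
(`κ ≠ 0`, `⟨w,u⟩ > 0`, constant terms `1`, degrees `≤ D`; coefficient of `z ≠ 0` written with single-product
fibre sums).  If its `w`-initial exponent `v` is off-ray, then either `v = u` (the upper corner is a vertex), or
the two lightest candidate terms cancel: `u` is the lightest order point `o_a E_a` of `U` and `κ = [s^{o_a}]U_a`.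
[this line; new, elementary] -/
theorem k8_two_norm {s D : ℕ} (E : Fin s → Fin 2 → ℤ) (w : Fin 2 → ℝ)
    (hw : ∀ e, 0 < wt w (E e)) (hgen : Function.Injective (wt w))
    (hE : ∀ e e' : Fin s, ∀ k k' : ℕ, 1 ≤ k → (k : ℤ) • E e = (k' : ℤ) • E e' → e = e')
    (κ : ℂ) (hκ : κ ≠ 0) (u : Fin 2 → ℤ) (hu : 0 < wt w u)
    (U V : Fin s → ℂ[X]) (hU0 : ∀ e, (U e).coeff 0 = 1) (hV0 : ∀ e, (V e).coeff 0 = 1)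
    (hUD : ∀ e, (U e).natDegree ≤ D)
    (o : Fin s → ℕ) (ho : ∀ e, Active (U e) → IsOrder (U e) (o e))
    (v : Fin 2 → ℤ) (hv0 : v ≠ 0) (hoff : ¬ OnRay E v)
    (hv : κ * fibreSum E D 1 0 V V (v - u) - fibreSum E D 1 0 U U v ≠ 0)
    (hcanc : ∀ z, z ≠ 0 → wt w z < wt w v →
      κ * fibreSum E D 1 0 V V (z - u) - fibreSum E D 1 0 U U z = 0) :
    v = u ∨ ∃ a, Active (U a) ∧ u = (o a : ℤ) • E a ∧ κ = (U a).coeff (o a) ∧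
      ∀ e, Active (U e) → (o a : ℝ) * wt w (E a) ≤ (o e : ℝ) * wt w (E e) := by
  classical
  have hu0 : u ≠ 0 := by intro h; rw [h, wt_zero] at hu; exact lt_irrefl _ hu
  have hV00 : fibreSum E D 1 0 V V 0 = 1 := k8_fib_zero E w hw V hV0
  -- the two summands of the coefficient at `v`
  have hsplit : fibreSum E D 1 0 V V (v - u) ≠ 0 ∨ fibreSum E D 1 0 U U v ≠ 0 := by
    by_contra h
    push Not at h
    apply hv; rw [h.1, h.2]; ring
  -- `V`-contributions sit at weight `≥ ⟨w,u⟩`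
  have hVge : fibreSum E D 1 0 V V (v - u) ≠ 0 → wt w u ≤ wt w v := by
    intro h
    have := k8_wt_nonneg_of_fib_ne_zero E w hw V h
    rw [show v - u = v + -u from sub_eq_add_neg v u, wt_add] at this
    have hneg : wt w (-u) = -wt w u := by
      have := wt_add w u (-u); rw [add_neg_cancel, wt_zero] at this; linarith
    linarith
  by_cases hA : ∃ e, Active (U e) ∧ (o e : ℝ) * wt w (E e) ≤ wt w u
  · -- Case: some order point of `U` weighs at most `u`; take the lightest active order `a`
    obtain ⟨e₀, hA0, he0⟩ := hA
    set AU := Finset.univ.filter fun e => Active (U e) with hAU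
    have hAUne : AU.Nonempty := ⟨e₀, Finset.mem_filter.mpr ⟨Finset.mem_univ _, hA0⟩⟩
    obtain ⟨a, ha, hamin⟩ := AU.exists_min_image (fun e => (o e : ℝ) * wt w (E e)) hAUne
    have haA : Active (U a) := (Finset.mem_filter.mp ha).2
    have hamin' : ∀ e, Active (U e) → (o a : ℝ) * wt w (E a) ≤ (o e : ℝ) * wt w (E e) :=
      fun e he => hamin e (Finset.mem_filter.mpr ⟨Finset.mem_univ _, he⟩)
    have hoa := ho a haA
    have hwr : wt w ((o a : ℤ) • E a) = (o a : ℝ) * wt w (E a) := by rw [wt_zsmul]; push_cast; ring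
    have hrle : wt w ((o a : ℤ) • E a) ≤ wt w u := by rw [hwr]; exact (hamin' e₀ hA0).trans he0
    have hrpos : 0 < wt w ((o a : ℤ) • E a) := by
      rw [hwr]; exact mul_pos (by exact_mod_cast hoa.1) (hw a)
    have hr0 : ((o a : ℤ) • E a) ≠ 0 := by
      intro h; rw [h, wt_zero] at hrpos; exact lt_irrefl _ hrpos
    have hfibr : fibreSum E D 1 0 U U ((o a : ℤ) • E a) = (U a).coeff (o a) :=
      k8_fib_orderPoint E w hw hE U hU0 hUD o ho a haA hamin'
    -- mixed `U`-words are heavier than `r`; so an off-ray `U`-contribution at `v` forces `wt r < wt v`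
    have hUmixed : fibreSum E D 1 0 U U v ≠ 0 → wt w ((o a : ℤ) • E a) < wt w v := by
      intro h
      obtain ⟨n, -, hpush, hUn⟩ := k8_exists_word h
      rw [hwr, ← hpush]
      exact k8_mixed_gt E w hw U o ho a hamin' n (two_le_card_of_offRay E hpush hv0 hoff) hUn
    rcases hrle.lt_or_eq with hlt | heq
    · -- `r` strictly lighter than `u`: `r` is an uncancelled lighter point — contradiction
      exfalso
      have hVr : fibreSum E D 1 0 V V ((o a : ℤ) • E a - u) = 0 := by
        by_contra h
        have h0 := k8_wt_nonneg_of_fib_ne_zero E w hw V h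
        rw [show (o a : ℤ) • E a - u = (o a : ℤ) • E a + -u from sub_eq_add_neg _ u, wt_add] at h0
        have hneg : wt w (-u) = -wt w u := by
          have := wt_add w u (-u); rw [add_neg_cancel, wt_zero] at this; linarith
        linarith
      have hrv : wt w ((o a : ℤ) • E a) < wt w v := by
        rcases hsplit with h | h
        · exact lt_of_lt_of_le hlt (hVge h)
        · exact hUmixed h
      have h0 := hcanc _ hr0 hrv
      rw [hVr, hfibr, mul_zero, zero_sub, neg_eq_zero] at h0
      exact hoa.2.1 h0
    · -- `r = u`
      have hru : (o a : ℤ) • E a = u := hgen heq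
      by_cases hκa : κ = (U a).coeff (o a)
      · exact Or.inr ⟨a, haA, hru.symm, hκa, hamin'⟩
      · -- the coefficient at `u` is `κ - [s^{o_a}]U_a ≠ 0`: `u` is an uncancelled point, so `v = u`
        left
        have hHu : κ * fibreSum E D 1 0 V V (u - u) - fibreSum E D 1 0 U U u ≠ 0 := by
          rw [sub_self, hV00, mul_one, ← hru, hfibr]
          exact sub_ne_zero.mpr hκa
        have hnot : ¬ wt w u < wt w v := fun h => hHu (hcanc u hu0 h)
        rcases hsplit with h | h
        · exact hgen (le_antisymm (not_lt.mp hnot) (hVge h))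
        · exfalso
          have := hUmixed h
          rw [hru] at this
          exact hnot this
  · -- Case: every order point of `U` is heavier than `u`: the corner `u` survives, `v = u`
    push Not at hA
    have hUu : fibreSum E D 1 0 U U u = 0 := by
      by_contra h
      obtain ⟨e, he, hle⟩ := k8_exists_active_letter E w hw U o ho hu0 h
      exact absurd hle (not_le.mpr (hA e he))
    have hHu : κ * fibreSum E D 1 0 V V (u - u) - fibreSum E D 1 0 U U u ≠ 0 := by
      rw [sub_self, hV00, mul_one, hUu, sub_zero]; exact hκ
    have hnot : ¬ wt w u < wt w v := fun h => hHu (hcanc u hu0 h)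
    left
    rcases hsplit with h | h
    · exact hgen (le_antisymm (not_lt.mp hnot) (hVge h))
    · exfalso
      obtain ⟨e, he, hle⟩ := k8_exists_active_letter E w hw U o ho hv0 h
      have := hA e he
      exact hnot (by linarith)

end Summit.ValiantsHypothesis.ValiantsHypothesis.Theorems.NewtonTauWeakCorner

end
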